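import Summits.CriticalPhenomena.SAWScalingLimit.Theorems.SAWWeldingIdentificationWeldingSetupConfigA

/-!
# Welding configurations, II: configuration independence and the welding equation
# (route `SAWWeldingIdentification`, helper for item `WeldingSetup`, stmt-CriticalPhenomena-4504)

For a conformal rectangle `Q` and a simple chord `γ` of `(Ω; a, b)`:

* `sign_eq_of_config`, `leftMap_eqOn`, `rightMap_eqOn`, `isWeld_iff_isWeld` — configuration
  independence: two welding configurations of the same chord have the same sign, and their
  uniformisers agree on `ℍ` (uniqueness of chordal maps up to dilation, tree:
  `exists_eq_trans_smul_holds`, plus the third point), hence the same welding relation;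
* `exists_isWeld` — the welding equation `ψ(s x) = φ(-s y)` has a positive solution `y` for
  every `x > 0` (both sides run through the open chord);
* `conformalWelding_pos_and_isWeld` — hence the Literature functional `conformalWelding Q γ`
  (`ConformalWelding.lean`, defined by choice) is positive and solves the welding equation of
  EVERY configuration: CLAUSE (ii) of item `WeldingSetup` verbatim (`weldingSetup_partII`);
  `conformalWelding_eq_of_isWeld` — and it is the only solution.

References: Ch. Pommerenke, *Boundary Behaviour of Conformal Maps* (1992), Thm. 2.6, Cor. 2.7;
S. Sheffield, Ann. Probab. 44 (2016), §1.4.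
-/

noncomputable section

namespace Summit.CriticalPhenomena.SAWScalingLimit.Theorems

open Set Filter Topology Complex Metric Function
open UpperHalfPlane (upperHalfPlaneSet)
open Literature.Probability.RandomPlanarGeometry Literature.Topology.PlaneTopology

variable {Q : ConformalRectangle} {γ : CurveClass ℂ}

/-! ### Configuration independence -/

section Indep

variable (hγ : (Q.chord 0 2 (by decide)).IsSimpleChord γ)
  (Φ : ConformalEquiv upperHalfPlaneSet (Q.chord 0 2 (by decide)).carrier)
  (hΦ : (Q.chord 0 2 (by decide)).IsChordalUniformizing Φ)
  {tL : ℝ} (htL : Φ.boundaryExtension tL = Q.pt 1) (htL0 : tL ≠ 0)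

include hγ hΦ htL in
/-- **The sign of a configuration is forced**: if `φ : ℍ → L` (left bank) has boundary values
`a` at `0`, `b` at `∞` and `c_L` at `s = ±1`, then `s = 1` when `t_L > 0` and `s = -1` when
`t_L < 0`. [folklore] -/
theorem sign_eq_of_config {L R : Set ℂ}
    (h : L ∪ R = Q.carrier \ γ.range ∧ Disjoint L R ∧ IsOpen L ∧ IsOpen R ∧ IsConnected L ∧
      IsConnected R ∧ Q.pt 1 ∈ closure L ∧ Q.pt 3 ∈ closure R)
    (φ : ConformalEquiv upperHalfPlaneSet L) (hφ0 : φ.HasBoundaryValue 0 (Q.pt 0))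
    (hφi : φ.HasBoundaryValueAtInfty (Q.pt 2)) {s : ℝ} (hs : s = 1 ∨ s = -1)
    (hφs : φ.HasBoundaryValue s (Q.pt 1)) : (0 < tL → s = 1) ∧ (tL < 0 → s = -1) := by
  refine ⟨fun ht => ?_, fun ht => ?_⟩
  · have := sign_left_pos hγ Φ hΦ htL h φ hφ0 hφi ht hφs
    rcases hs with rfl | rfl
    · rfl
    · linarith
  · have := sign_left_neg hγ Φ hΦ htL h φ hφ0 hφi ht hφs
    rcases hs with rfl | rfl
    · linarith
    · rfl

include hγ hΦ htL htL0 in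
/-- Two admissible signs of configurations of the same chord coincide. [folklore] -/
theorem sign_eq_sign {L R L' R' : Set ℂ}
    (h : L ∪ R = Q.carrier \ γ.range ∧ Disjoint L R ∧ IsOpen L ∧ IsOpen R ∧ IsConnected L ∧
      IsConnected R ∧ Q.pt 1 ∈ closure L ∧ Q.pt 3 ∈ closure R)
    (h' : L' ∪ R' = Q.carrier \ γ.range ∧ Disjoint L' R' ∧ IsOpen L' ∧ IsOpen R' ∧ IsConnected L' ∧
      IsConnected R' ∧ Q.pt 1 ∈ closure L' ∧ Q.pt 3 ∈ closure R')
    (φ : ConformalEquiv upperHalfPlaneSet L) (hφ0 : φ.HasBoundaryValue 0 (Q.pt 0))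
    (hφi : φ.HasBoundaryValueAtInfty (Q.pt 2)) {s : ℝ} (hs : s = 1 ∨ s = -1)
    (hφs : φ.HasBoundaryValue s (Q.pt 1))
    (φ' : ConformalEquiv upperHalfPlaneSet L') (hφ'0 : φ'.HasBoundaryValue 0 (Q.pt 0))
    (hφ'i : φ'.HasBoundaryValueAtInfty (Q.pt 2)) {s' : ℝ} (hs' : s' = 1 ∨ s' = -1)
    (hφ's : φ'.HasBoundaryValue s' (Q.pt 1)) : s = s' := by
  have h1 := sign_eq_of_config hγ Φ hΦ htL h φ hφ0 hφi hs hφs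
  have h2 := sign_eq_of_config hγ Φ hΦ htL h' φ' hφ'0 hφ'i hs' hφ's
  rcases lt_or_gt_of_ne htL0 with ht | ht
  · rw [h1.2 ht, h2.2 ht]
  · rw [h1.1 ht, h2.1 ht]

/-- **Uniqueness of the three-point-normalised uniformiser** of a Dobrushin domain: two chordal
uniformisers `φ, φ' : (ℍ; 0, ∞) → (D; a, b)` with the same boundary value `c` at the same real
point `s ≠ 0` agree on `ℍ` (they differ by a dilation `z ↦ k z`, Pommerenke 1992 Cor. 2.7 /
tree `exists_eq_trans_smul_holds`, and `φ(k s) = c = φ(s)` forces `k = 1` by injectivity of the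
boundary correspondence). [folklore] -/
theorem eqOn_of_isChordalUniformizing_of_hasBoundaryValue {D : DobrushinDomain}
    (φ φ' : ConformalEquiv upperHalfPlaneSet D.carrier) (hφ : D.IsChordalUniformizing φ)
    (hφ' : D.IsChordalUniformizing φ') {s : ℝ} (hs : s ≠ 0) {c : ℂ}
    (hφs : φ.HasBoundaryValue s c) (hφ's : φ'.HasBoundaryValue s c) :
    EqOn φ φ' upperHalfPlaneSet := by
  obtain ⟨k, hk, heq⟩ := MarkedDomain.IsChordalUniformizing.exists_eq_trans_smul_holds hφ hφ'
  -- `φ' → φ̄ (k s)` at `s`, hence `φ̄ (k s) = c = φ̄ s`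
  have h1 : Tendsto φ' (𝓝[upperHalfPlaneSet] (s : ℂ)) (𝓝 (φ.boundaryExtension ((k * s : ℝ) : ℂ))) := by
    have h := hasBoundaryValue_smul_trans φ hk (tendsto_boundaryExtension_ofReal φ (k * s))
    exact h.congr' (eventually_nhdsWithin_of_forall fun z hz => (heq hz).symm)
  haveI : NeBot (𝓝[upperHalfPlaneSet] (s : ℂ)) :=
    mem_closure_iff_nhdsWithin_neBot.1 (mem_closure_upperHalfPlaneSet_iff.2 (by simp))
  have h2 : φ.boundaryExtension ((k * s : ℝ) : ℂ) = c := tendsto_nhds_unique h1 hφ's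
  have h3 : φ.boundaryExtension (s : ℂ) = c :=
    JordanDomain.boundaryExtension_eq_of_hasBoundaryValue' φ (by simp) hφs
  have h4 : ((k * s : ℝ) : ℂ) = (s : ℂ) :=
    JordanDomain.injOn_boundaryExtension φ (by simp) (by simp) (h2.trans h3.symm)
  have hk1 : k = 1 := by
    have h5 : k * s = s := by exact_mod_cast h4
    field_simp at h5
    linarith [h5]
  subst hk1
  intro z hz
  rw [heq hz, ConformalEquiv.trans_apply, ConformalEquiv.smulUpperHalfPlane_apply, one_smul]

include hγ hΦ htL htL0 in
/-- **Configuration independence, left bank**: two normalised uniformisers of the left bank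
(boundary values `a, b, c_L` at `0, ∞, ±1`) agree on `ℍ`. [folklore] -/
theorem leftMap_eqOn {L R : Set ℂ}
    (h : L ∪ R = Q.carrier \ γ.range ∧ Disjoint L R ∧ IsOpen L ∧ IsOpen R ∧ IsConnected L ∧
      IsConnected R ∧ Q.pt 1 ∈ closure L ∧ Q.pt 3 ∈ closure R)
    (φ φ' : ConformalEquiv upperHalfPlaneSet L) (hφ0 : φ.HasBoundaryValue 0 (Q.pt 0))
    (hφi : φ.HasBoundaryValueAtInfty (Q.pt 2)) (hφ'0 : φ'.HasBoundaryValue 0 (Q.pt 0))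
    (hφ'i : φ'.HasBoundaryValueAtInfty (Q.pt 2)) {s s' : ℝ} (hs : s = 1 ∨ s = -1)
    (hs' : s' = 1 ∨ s' = -1) (hφs : φ.HasBoundaryValue s (Q.pt 1))
    (hφ's : φ'.HasBoundaryValue s' (Q.pt 1)) : EqOn φ φ' upperHalfPlaneSet := by
  have hss' : s = s' := sign_eq_sign hγ Φ hΦ htL htL0 h h φ hφ0 hφi hs hφs φ' hφ'0 hφ'i hs' hφ's
  subst hss'
  obtain ⟨p, hp, hpinj, hprange, hp0, hp1⟩ := exists_param_of_isSimpleChord hγ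
  obtain ⟨D, hDL, hDa, hDb, -⟩ := exists_leftBank_dobrushinDomain hγ h hp hpinj hprange hp0 hp1
  subst hDL
  have hs0 : s ≠ 0 := by rcases hs with rfl | rfl <;> norm_num
  exact eqOn_of_isChordalUniformizing_of_hasBoundaryValue φ φ'
    ⟨by rw [hDa]; exact hφ0, by rw [hDb]; exact hφi⟩ ⟨by rw [hDa]; exact hφ'0, by rw [hDb]; exact hφ'i⟩
    hs0 hφs hφ's

include hγ hΦ htL htL0 in
/-- **Configuration independence, right bank**: two normalised uniformisers of the right bank
(boundary values `a, b, c_R` at `0, ∞, ∓1`) agree on `ℍ`. [folklore] -/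
theorem rightMap_eqOn {L R : Set ℂ}
    (h : L ∪ R = Q.carrier \ γ.range ∧ Disjoint L R ∧ IsOpen L ∧ IsOpen R ∧ IsConnected L ∧
      IsConnected R ∧ Q.pt 1 ∈ closure L ∧ Q.pt 3 ∈ closure R)
    (ψ ψ' : ConformalEquiv upperHalfPlaneSet R) (hψ0 : ψ.HasBoundaryValue 0 (Q.pt 0))
    (hψi : ψ.HasBoundaryValueAtInfty (Q.pt 2)) (hψ'0 : ψ'.HasBoundaryValue 0 (Q.pt 0))
    (hψ'i : ψ'.HasBoundaryValueAtInfty (Q.pt 2)) {s s' : ℝ} (hs : s = 1 ∨ s = -1)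
    (hs' : s' = 1 ∨ s' = -1) (hψs : ψ.HasBoundaryValue (-(s : ℂ)) (Q.pt 3))
    (hψ's : ψ'.HasBoundaryValue (-(s' : ℂ)) (Q.pt 3)) : EqOn ψ ψ' upperHalfPlaneSet := by
  obtain ⟨p, hp, hpinj, hprange, hp0, hp1⟩ := exists_param_of_isSimpleChord hγ
  obtain ⟨D, hDR, hDa, hDb, -⟩ := exists_rightBank_dobrushinDomain hγ h hp hpinj hprange hp0 hp1
  subst hDR
  rw [← ofReal_neg] at hψs hψ's
  -- both `-s` and `-s'` have the sign opposite to `t_L`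
  have key : ∀ {u : ℝ}, (u = 1 ∨ u = -1) → ψ.HasBoundaryValue ((-u : ℝ) : ℂ) (Q.pt 3) ∨
      ψ'.HasBoundaryValue ((-u : ℝ) : ℂ) (Q.pt 3) → (0 < tL → u = 1) ∧ (tL < 0 → u = -1) := by
    intro u hu hbv
    refine ⟨fun ht => ?_, fun ht => ?_⟩
    · have hneg : -u < 0 := by
        rcases hbv with hbv | hbv
        · exact sign_right_pos hγ Φ hΦ htL h ψ hψ0 hψi ht hbv
        · exact sign_right_pos hγ Φ hΦ htL h ψ' hψ'0 hψ'i ht hbv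
      rcases hu with rfl | rfl
      · rfl
      · linarith
    · have hpos : 0 < -u := by
        rcases hbv with hbv | hbv
        · exact sign_right_neg hγ Φ hΦ htL h ψ hψ0 hψi ht hbv
        · exact sign_right_neg hγ Φ hΦ htL h ψ' hψ'0 hψ'i ht hbv
      rcases hu with rfl | rfl
      · linarith
      · rfl
  have hss' : s = s' := by
    have h1 := key hs (Or.inl hψs)
    have h2 := key hs' (Or.inr hψ's)
    rcases lt_or_gt_of_ne htL0 with ht | ht
    · rw [h1.2 ht, h2.2 ht]
    · rw [h1.1 ht, h2.1 ht]
  subst hss'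
  have hs0 : -s ≠ 0 := by rcases hs with rfl | rfl <;> norm_num
  exact eqOn_of_isChordalUniformizing_of_hasBoundaryValue ψ ψ'
    ⟨by rw [hDa]; exact hψ0, by rw [hDb]; exact hψi⟩ ⟨by rw [hDa]; exact hψ'0, by rw [hDb]; exact hψ'i⟩
    hs0 hψs hψ's

include hγ hΦ htL htL0 in
/-- **Configuration independence of the welding relation**: any two welding configurations of
the same chord have the same welding relation at all parameters. [folklore] -/
theorem isWeld_iff_isWeld (c c' : WeldingConfig Q γ) (x y : ℝ) : c.IsWeld x y ↔ c'.IsWeld x y := by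
  obtain ⟨s, L, R, φ, ψ, hs, hb, hn⟩ := c
  obtain ⟨s', L', R', φ', ψ', hs', hb', hn'⟩ := c'
  obtain ⟨hLL, hRR⟩ := banks_unique hγ hb' hb
  subst hLL hRR
  obtain ⟨hφ0, hφi, hφs, hψ0, hψi, hψs⟩ := hn
  obtain ⟨hφ'0, hφ'i, hφ's, hψ'0, hψ'i, hψ's⟩ := hn'
  have hss : s = s' := sign_eq_sign hγ Φ hΦ htL htL0 hb hb' φ hφ0 hφi hs hφs φ' hφ'0 hφ'i hs' hφ's
  subst hss
  have hL : EqOn φ φ' upperHalfPlaneSet :=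
    leftMap_eqOn hγ Φ hΦ htL htL0 hb φ φ' hφ0 hφi hφ'0 hφ'i hs hs hφs hφ's
  have hR : EqOn ψ ψ' upperHalfPlaneSet :=
    rightMap_eqOn hγ Φ hΦ htL htL0 hb ψ ψ' hψ0 hψi hψ'0 hψ'i hs hs hψs hψ's
  show ψ.boundaryExtension _ = φ.boundaryExtension _ ↔ ψ'.boundaryExtension _ = φ'.boundaryExtension _
  rw [φ.boundaryExtension_congr φ' hL, ψ.boundaryExtension_congr ψ' hR]

end Indep

/-! ### Existence of positive solutions of the welding equation -/

/-- **The welding equation has positive solutions.** For a welding configuration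
`(s, L, R, φ, ψ)` of a simple chord and `x > 0`, the point `ψ(s x)` lies on the open chord, which
is also the `φ`-image of the half-line `-s · (0, ∞)`; so `ψ(s x) = φ(-s y)` for some `y > 0`.
[folklore] -/
theorem exists_isWeld (hγ : (Q.chord 0 2 (by decide)).IsSimpleChord γ) (c : WeldingConfig Q γ)
    {x : ℝ} (hx : 0 < x) : ∃ y : ℝ, 0 < y ∧ c.IsWeld x y := by
  obtain ⟨s, L, R, φ, ψ, hs, hb, hφ0, hφi, hφs, hψ0, hψi, hψs⟩ := c
  rcases hs with rfl | rfl
  · -- `s = 1`: `φ((-∞,0)) = γ° = ψ((0,∞))`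
    have hL := (image_halfLines_left_of_pos hγ hb φ hφ0 hφi one_pos (by simpa using hφs)).2
    have hR := (image_halfLines_right_of_neg hγ hb ψ hψ0 hψi (by norm_num : (-1 : ℝ) < 0)
      (by simpa using hψs)).2
    have hmem : ψ.boundaryExtension (x : ℂ) ∈ γ.range \ {Q.pt 0, Q.pt 2} := hR ▸ ⟨x, hx, rfl⟩
    rw [← hL] at hmem
    obtain ⟨t, ht, hteq⟩ := hmem
    refine ⟨-t, by linarith [show t < 0 from ht], ?_⟩
    show ψ.boundaryExtension (((1 : ℝ) * x : ℝ) : ℂ) = φ.boundaryExtension ((-((1 : ℝ) * -t) : ℝ) : ℂ)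
    rw [one_mul, one_mul, neg_neg]
    exact hteq.symm
  · -- `s = -1`: `φ((0,∞)) = γ° = ψ((-∞,0))`
    have hL := (image_halfLines_left_of_neg hγ hb φ hφ0 hφi (by norm_num : (-1 : ℝ) < 0)
      (by simpa using hφs)).2
    have hR := (image_halfLines_right_of_pos hγ hb ψ hψ0 hψi one_pos (by simpa using hψs)).2
    have hmem : ψ.boundaryExtension ((-x : ℝ) : ℂ) ∈ γ.range \ {Q.pt 0, Q.pt 2} :=
      hR ▸ ⟨-x, neg_lt_zero.2 hx, rfl⟩
    rw [← hL] at hmem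
    obtain ⟨t, ht, hteq⟩ := hmem
    refine ⟨t, ht, ?_⟩
    show ψ.boundaryExtension (((-1 : ℝ) * x : ℝ) : ℂ) = φ.boundaryExtension ((-((-1 : ℝ) * t) : ℝ) : ℂ)
    rw [neg_one_mul, neg_one_mul, neg_neg]
    exact hteq.symm

/-! ### Clause (ii) of the item: the conformal welding solves every configuration -/

/-- **The conformal welding is positive and solves the welding equation of every
configuration** (`conformalWelding_spec` of `ConformalWelding.lean` with its two inputs
discharged: configuration independence `isWeld_iff_isWeld` and existence `exists_isWeld`).
[folklore] -/
theorem conformalWelding_pos_and_isWeld (hγ : (Q.chord 0 2 (by decide)).IsSimpleChord γ)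
    (c : WeldingConfig Q γ) {x : ℝ} (hx : 0 < x) :
    0 < conformalWelding Q γ x ∧ c.IsWeld x (conformalWelding Q γ x) := by
  obtain ⟨Φ, hΦ⟩ := MarkedDomain.exists_isChordalUniformizing_holds (Q.chord 0 2 (by decide))
  obtain ⟨tL, htL0, htL⟩ := exists_boundaryExtension_eq_pt_one Φ hΦ
  exact conformalWelding_spec hγ c (fun c' x y _ _ => isWeld_iff_isWeld hγ Φ hΦ htL htL0 c' c x y)
    (fun x hx => exists_isWeld hγ c hx) hx

/-- **The conformal welding is THE solution** of the welding equation of any configuration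
(injectivity of the boundary correspondence of `φ`). [folklore] -/
theorem conformalWelding_eq_of_isWeld (hγ : (Q.chord 0 2 (by decide)).IsSimpleChord γ)
    (c : WeldingConfig Q γ) {x y : ℝ} (hx : 0 < x) (hw : c.IsWeld x y) :
    conformalWelding Q γ x = y := by
  obtain ⟨hpos, hW⟩ := conformalWelding_pos_and_isWeld hγ c hx
  obtain ⟨s, L, R, φ, ψ, hs, hb, hn⟩ := c
  obtain ⟨p, hp, hpinj, hprange, hp0, hp1⟩ := exists_param_of_isSimpleChord hγ
  obtain ⟨D, hDL, -, -, -⟩ := exists_leftBank_dobrushinDomain hγ hb hp hpinj hprange hp0 hp1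
  subst hDL
  have h1 : φ.boundaryExtension ((-(s * conformalWelding Q γ x) : ℝ) : ℂ) =
      φ.boundaryExtension ((-(s * y) : ℝ) : ℂ) := hW.symm.trans hw
  have h2 := JordanDomain.injOn_boundaryExtension φ (by simp) (by simp) h1
  have h3 : -(s * conformalWelding Q γ x) = -(s * y) := by exact_mod_cast h2
  have hs0 : s ≠ 0 := by rcases hs with rfl | rfl <;> norm_num
  have := neg_injective h3
  exact mul_left_cancel₀ hs0 this

/-- **Clause (ii) of item `WeldingSetup`, verbatim**, for the Literature functional
`W := conformalWelding`: for every conformal rectangle, every simple chord, every admissible sign,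
bank pair and pair of normalised uniformisers, and every `x > 0`, `0 < W Q γ x` and
`ψ(s x) = φ(-s · W Q γ x)` on boundary extensions. [folklore] -/
theorem weldingSetup_partII (Q : ConformalRectangle) (γ : CurveClass ℂ) (s : ℝ) (L R : Set ℂ)
    (φ : ConformalEquiv upperHalfPlaneSet L) (ψ : ConformalEquiv upperHalfPlaneSet R)
    (hγ : γ ∈ CurveClass.simple ∧ γ.source = Q.pt 0 ∧ γ.target = Q.pt 2 ∧
      γ.range ⊆ closure Q.carrier ∧ γ.range ∩ frontier Q.carrier ⊆ {Q.pt 0, Q.pt 2})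
    (hs : s = 1 ∨ s = -1)
    (hb : L ∪ R = Q.carrier \ γ.range ∧ Disjoint L R ∧ IsOpen L ∧ IsOpen R ∧ IsConnected L ∧
      IsConnected R ∧ Q.pt 1 ∈ closure L ∧ Q.pt 3 ∈ closure R)
    (hn : φ.HasBoundaryValue 0 (Q.pt 0) ∧ φ.HasBoundaryValueAtInfty (Q.pt 2) ∧
      φ.HasBoundaryValue ((s : ℝ) : ℂ) (Q.pt 1) ∧ ψ.HasBoundaryValue 0 (Q.pt 0) ∧
      ψ.HasBoundaryValueAtInfty (Q.pt 2) ∧ ψ.HasBoundaryValue (-((s : ℝ) : ℂ)) (Q.pt 3))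
    (x : ℝ) (hx : 0 < x) :
    0 < conformalWelding Q γ x ∧ ψ.boundaryExtension ((s * x : ℝ) : ℂ) =
      φ.boundaryExtension ((-(s * conformalWelding Q γ x) : ℝ) : ℂ) :=
  conformalWelding_pos_and_isWeld hγ ⟨s, L, R, φ, ψ, hs, hb, hn⟩ hx

end Summit.CriticalPhenomena.SAWScalingLimit.Theorems
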